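import Literature.Barriers.MatrixMultiplication.NilpotentGroupBarrierGradedCoords
import HarnessLib

/-!
# Twisted slice rank: the codimension bound survives weighted sums of filtered twists

Solo-informed seat (MatrixMultiplication), gen 101. Kernel form of the mechanism behind the
seat's "Theorem B″" (sharpest-statement §2y(8)): the first barrier on Cohn–Umans 2013, Conj. 21
(`ω = 2` via commutative association schemes) beyond their Thm 17, for TRANSLATION SCHEMES.

Let `B` be graded coordinates on `K[G]` (`GradedCoords`: BCCGU 2017, Prop. 3.2 in coordinates,
`slice-rank D_G ≤ N(a,b) := #{deg < a} + #{deg < b} + #{deg ≥ a+b}`). For a finite family of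
pairs of maps `φ_s, ψ_s : G → G` that are FILTERED with respect to `B` (the `β_j`-coordinate of
the push-forward of `β_{j'}` vanishes when `deg j < deg j'`; automatic for group automorphisms
preserving the filtration `F_a = span{β_k : deg k ≥ a}`, e.g. for all automorphisms when the
`F_a` are the powers of the augmentation ideal) and ARBITRARY weights `t_s ∈ K`, the weighted
twisted tensor `F_t(x,y,z) = Σ_s t_s [x · φ_s(y) · ψ_s(z) = 1]` still has `slice-rank ≤ N(a,b)`:
the SAME bound as `D_G`, with no factor for the number of twists
(`hasSliceRankLE_twistedTensor`). Consequently a TWISTED MATCHING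
(`x_i φ_s(y_j) ψ_s(z_l) = 1` for some `s` only if `i = j = l`) whose diagonal weight sums
`Σ_{s : x_i φ_s(y_i) ψ_s(z_i) = 1} t_s` are non-zero has at most `N(a,b)` elements
(`card_le_of_twistedMatching`, by Tao's diagonal lemma). A realization of `⟨n,n,n⟩`
(CU13 Def. 12) in the translation scheme `𝒮(G, M₀)`, restricted to an induced matching of the
matrix-multiplication support, is such a twisted matching with twists `M₀ × M₀`, and over a field
with more elements than the matching the weights can be chosen with non-zero diagonal sums; this
file is the slice-rank half of that argument.

No new definitions: the transfer matrices `Σ_x P(j',x) Q(f x, j)` (middle leg) and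
`Σ_b P(k,(g b⁻¹)⁻¹) Q(b,k')` (right leg) and the combined core are written out in place.

References: BlasiakChurchCohnGrochowUmans2017 (arXiv:1712.02302) §2.3, Prop. 3.2;
BlasiakChurchCohnGrochowNaslundSawinUmans2017 (arXiv:1605.06702) Lemma 4.7, Prop. 4.8;
CohnUmans2013 (arXiv:1207.6528) Def. 12, Conj. 21.
-/

noncomputable section

open scoped BigOperators
open Finset Literature.Combinatorics.Additive Literature.Barriers.MatrixMultiplication

namespace Summit.MatrixMultiplication.MatrixMultiplication.Theorems.TwistedSliceRank

universe u v w

variable {K : Type v} [Field K] {G : Type u} [Group G] [Fintype G] [DecidableEq G]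
  {Λ : Type w} [Fintype Λ] {σ : Type*} [Fintype σ]

/-! ## Generic finite-sum exchanges -/

/-- `Σ_a f a · Σ_b g b · h a b = Σ_b g b · Σ_a f a · h a b`. [folklore] -/
theorem sum_mul_sum_swap {α β : Type*} [Fintype α] [Fintype β] (f : α → K) (g : β → K)
    (h : α → β → K) :
    ∑ a, f a * ∑ b, g b * h a b = ∑ b, g b * ∑ a, f a * h a b := by
  simp_rw [Finset.mul_sum]
  rw [Finset.sum_comm]
  exact Finset.sum_congr rfl fun b _ => Finset.sum_congr rfl fun a _ => by ring

/-- `Σ_a (Σ_b f a b · g b) · h a = Σ_b g b · Σ_a f a b · h a`. [folklore] -/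
theorem sum_sum_mul_swap {α β : Type*} [Fintype α] [Fintype β] (f : α → β → K) (g : β → K)
    (h : α → K) :
    ∑ a, (∑ b, f a b * g b) * h a = ∑ b, g b * ∑ a, f a b * h a := by
  simp_rw [Finset.sum_mul, Finset.mul_sum]
  rw [Finset.sum_comm]
  exact Finset.sum_congr rfl fun b _ => Finset.sum_congr rfl fun a _ => by ring

/-- `Σ_a (Σ_b g b · f b a) · h a = Σ_b g b · Σ_a f b a · h a`. [folklore] -/
theorem sum_sum_mul_swap' {α β : Type*} [Fintype α] [Fintype β] (f : β → α → K) (g : β → K)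
    (h : α → K) :
    ∑ a, (∑ b, g b * f b a) * h a = ∑ b, g b * ∑ a, f b a * h a := by
  simp_rw [Finset.sum_mul, Finset.mul_sum]
  rw [Finset.sum_comm]
  exact Finset.sum_congr rfl fun b _ => Finset.sum_congr rfl fun a _ => by ring

/-! ## Twisting one leg: the transfer matrices -/

/-- Expansion of the middle leg after a twist `f`:
`Q(f y, j) = Σ_{j'} Q(y, j') · (Σ_x P(j', x) Q(f x, j))` (the bracket is the `β_j`-coordinate of
the push-forward of `β_{j'}` along `f`). [cite: BlasiakChurchCohnGrochowUmans2017, §2.3] -/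
theorem Q_twist (B : GradedCoords K G Λ) (f : G → G) (y : G) (j : Λ) :
    B.Q (f y) j = ∑ j', B.Q y j' * ∑ x, B.P j' x * B.Q (f x) j :=
  (B.sum_Q_mul_sum y (fun x => B.Q (f x) j)).symm

/-- Every function on `G` is a combination of the rows `P(k', ·)`. [folklore] -/
theorem expand_rows (B : GradedCoords K G Λ) (F : G → K) (w : G) :
    F w = ∑ k', (∑ b, F b * B.Q b k') * B.P k' w := by
  have h : ∀ k', (∑ b, F b * B.Q b k') * B.P k' w = ∑ b, F b * (B.Q b k' * B.P k' w) := by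
    intro k'
    rw [Finset.sum_mul]
    exact Finset.sum_congr rfl fun b _ => by ring
  simp_rw [h]
  rw [Finset.sum_comm]
  simp_rw [← Finset.mul_sum, B.sum_Q_mul_P, mul_ite, mul_one, mul_zero]
  rw [Finset.sum_ite_eq' Finset.univ w]
  simp

/-- Expansion of the right leg after a twist `g` (through the inversion built into `D_G`):
`P(k, (g z)⁻¹) = Σ_{k'} (Σ_b P(k, (g b⁻¹)⁻¹) Q(b, k')) · P(k', z⁻¹)`.
[cite: BlasiakChurchCohnGrochowUmans2017, §2.3] -/
theorem P_twist (B : GradedCoords K G Λ) (g : G → G) (z : G) (k : Λ) :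
    B.P k (g z)⁻¹ = ∑ k', (∑ b, B.P k (g b⁻¹)⁻¹ * B.Q b k') * B.P k' z⁻¹ := by
  have h := expand_rows B (fun b => B.P k (g b⁻¹)⁻¹) z⁻¹
  simp only [inv_inv] at h
  exact h

/-- One twisted term in coordinates: the structure constants `c'(i,j;k)` substituted along the
two transfer matrices and then along `Q, Q, P(·, z⁻¹)`. [this work] -/
theorem mulGroupTensor_twist_eq (B : GradedCoords K G Λ) (f g : G → G) (x y z : G) :
    mulGroupTensor K G x (f y) (g z) =
      ∑ k', B.P k' z⁻¹ * ∑ j', B.Q y j' * ∑ i, B.Q x i *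
        ∑ k, (∑ b, B.P k (g b⁻¹)⁻¹ * B.Q b k') *
          ∑ j, (∑ x', B.P j' x' * B.Q (f x') j) * B.strConst i j k := by
  have h0 := congrFun (congrFun (congrFun B.mulGroupTensor_eq_subst x) (f y)) (g z)
  rw [h0]
  simp_rw [P_twist B g z, Q_twist B f y]
  -- pull `Σ_{k'} P(k', z⁻¹)` out
  rw [sum_sum_mul_swap (fun k k' => ∑ b, B.P k (g b⁻¹)⁻¹ * B.Q b k') (fun k' => B.P k' z⁻¹)]
  refine Finset.sum_congr rfl fun k' _ => ?_
  congr 1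
  -- pull `Σ_{j'} Q(y, j')` out of each `k`-term, then out of the `k`-sum
  have h1 : ∀ k, (∑ j, (∑ j', B.Q y j' * ∑ x', B.P j' x' * B.Q (f x') j) *
      ∑ i, B.Q x i * B.strConst i j k) =
      ∑ j', B.Q y j' * ∑ j, (∑ x', B.P j' x' * B.Q (f x') j) *
        ∑ i, B.Q x i * B.strConst i j k :=
    fun k => sum_sum_mul_swap' (fun j' j => ∑ x', B.P j' x' * B.Q (f x') j) (fun j' => B.Q y j') _
  simp_rw [h1]
  rw [sum_mul_sum_swap (fun k => ∑ b, B.P k (g b⁻¹)⁻¹ * B.Q b k') (fun j' => B.Q y j')]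
  refine Finset.sum_congr rfl fun j' _ => ?_
  congr 1
  -- pull `Σ_i Q(x, i)` out of the `j`-sum, then out of the `k`-sum
  have h2 : ∀ k, (∑ j, (∑ x', B.P j' x' * B.Q (f x') j) * ∑ i, B.Q x i * B.strConst i j k) =
      ∑ i, B.Q x i * ∑ j, (∑ x', B.P j' x' * B.Q (f x') j) * B.strConst i j k :=
    fun k => sum_mul_sum_swap (fun j => ∑ x', B.P j' x' * B.Q (f x') j) (fun i => B.Q x i) _
  simp_rw [h2]
  exact sum_mul_sum_swap (fun k => ∑ b, B.P k (g b⁻¹)⁻¹ * B.Q b k') (fun i => B.Q x i) _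

/-- **The weighted twisted tensor in coordinates**: `F_t` is the combined core
`C(i,j';k') = Σ_s t_s Σ_k Σ_j R_s(k,k') M_s(j',j) c'(i,j;k)` substituted along `Q, Q, P(·, z⁻¹)`.
[this work] -/
theorem twistedTensor_eq_subst (B : GradedCoords K G Λ) (t : σ → K) (φ ψ : σ → G → G) :
    (fun x y z => ∑ s, t s * mulGroupTensor K G x (φ s y) (ψ s z)) = fun x y z =>
      ∑ k', B.P k' z⁻¹ * ∑ j', B.Q y j' * ∑ i, B.Q x i *
        ∑ s, t s * ∑ k, (∑ b, B.P k (ψ s b⁻¹)⁻¹ * B.Q b k') *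
          ∑ j, (∑ x', B.P j' x' * B.Q (φ s x') j) * B.strConst i j k := by
  funext x y z
  simp_rw [mulGroupTensor_twist_eq B]
  rw [sum_mul_sum_swap t (fun k' => B.P k' z⁻¹)]
  refine Finset.sum_congr rfl fun k' _ => ?_
  congr 1
  rw [sum_mul_sum_swap t (fun j' => B.Q y j')]
  refine Finset.sum_congr rfl fun j' _ => ?_
  congr 1
  exact sum_mul_sum_swap t (fun i => B.Q x i) _

/-! ## Filtered twists give a graded core -/

/-- The combined core is graded when all twists are filtered: if pushing `β_{j'}` along `φ_s`
creates no `β_j` of smaller degree and pulling `β_k` back along `ψ_s` creates no `β_{k'}` of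
smaller degree, then `C(i,j';k') ≠ 0 ⟹ deg i + deg j' ≤ deg k'`. [this work] -/
theorem twistedCore_graded (B : GradedCoords K G Λ) (t : σ → K) (φ ψ : σ → G → G)
    (hφ : ∀ s (j' j : Λ), B.deg j < B.deg j' → ∑ x', B.P j' x' * B.Q (φ s x') j = 0)
    (hψ : ∀ s (k k' : Λ), B.deg k' < B.deg k → ∑ b, B.P k (ψ s b⁻¹)⁻¹ * B.Q b k' = 0)
    (i j' k' : Λ)
    (hne : (∑ s, t s * ∑ k, (∑ b, B.P k (ψ s b⁻¹)⁻¹ * B.Q b k') *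
      ∑ j, (∑ x', B.P j' x' * B.Q (φ s x') j) * B.strConst i j k) ≠ 0) :
    B.deg i + B.deg j' ≤ B.deg k' := by
  by_contra hlt
  apply hne
  refine Finset.sum_eq_zero fun s _ => ?_
  rw [mul_eq_zero]; right
  refine Finset.sum_eq_zero fun k _ => ?_
  by_cases hk : B.deg k' < B.deg k
  · rw [hψ s k k' hk, zero_mul]
  rw [mul_eq_zero]; right
  refine Finset.sum_eq_zero fun j _ => ?_
  by_cases hj : B.deg j < B.deg j'
  · rw [hφ s j' j hj, zero_mul]
  rw [mul_eq_zero]; right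
  by_contra hc
  have h3 := B.graded i j k hc
  omega

/-! ## The twisted codimension bound and the twisted matching bound -/

/-- **Twisted codimension bound.** For filtered twists `φ_s, ψ_s` and arbitrary weights `t_s`,
`slice-rank (Σ_s t_s [x · φ_s(y) · ψ_s(z) = 1]) ≤ #{deg < a} + #{deg < b} + #{deg ≥ a + b}`,
the bound of BCCGU 2017 Prop. 3.2 for `D_G` itself, independent of the number of twists.
[this work] -/
theorem hasSliceRankLE_twistedTensor (B : GradedCoords K G Λ) [DecidableEq Λ] (t : σ → K)
    (φ ψ : σ → G → G)
    (hφ : ∀ s (j' j : Λ), B.deg j < B.deg j' → ∑ x', B.P j' x' * B.Q (φ s x') j = 0)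
    (hψ : ∀ s (k k' : Λ), B.deg k' < B.deg k → ∑ b, B.P k (ψ s b⁻¹)⁻¹ * B.Q b k' = 0)
    (a b : ℕ) :
    HasSliceRankLE (fun x y z => ∑ s, t s * mulGroupTensor K G x (φ s y) (ψ s z))
      (Fintype.card {i : Λ // B.deg i < a} + Fintype.card {j : Λ // B.deg j < b} +
        Fintype.card {k : Λ // a + b ≤ B.deg k}) := by
  rw [twistedTensor_eq_subst B]
  exact (((HasSliceRankLE.of_graded _ B.deg B.deg B.deg
    (twistedCore_graded B t φ ψ hφ hψ) a b).subst_left B.Q).subst_mid B.Q).subst_right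
    (fun z k => B.P k z⁻¹)

/-- **Twisted matching bound** (Tao's diagonal lemma applied to the twisted tensor). If
`x_i · φ_s(y_j) · ψ_s(z_l) = 1` for some twist `s` forces `i = j = l`, and on the diagonal the
weights of the solving twists do not sum to zero, then the matching has at most
`#{deg < a} + #{deg < b} + #{deg ≥ a + b}` elements — for every choice of filtered twists and
weights. [this work] -/
theorem card_le_of_twistedMatching (B : GradedCoords K G Λ) [DecidableEq Λ] (t : σ → K)
    (φ ψ : σ → G → G)
    (hφ : ∀ s (j' j : Λ), B.deg j < B.deg j' → ∑ x', B.P j' x' * B.Q (φ s x') j = 0)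
    (hψ : ∀ s (k k' : Λ), B.deg k' < B.deg k → ∑ b, B.P k (ψ s b⁻¹)⁻¹ * B.Q b k' = 0)
    {ι : Type*} [Fintype ι] (x y z : ι → G)
    (hoff : ∀ (i j l : ι) (s : σ), x i * φ s (y j) * ψ s (z l) = 1 → i = j ∧ j = l)
    (hdiag : ∀ i : ι, (∑ s, t s * (if x i * φ s (y i) * ψ s (z i) = 1 then (1 : K) else 0)) ≠ 0)
    (a b : ℕ) :
    Fintype.card ι ≤ Fintype.card {i : Λ // B.deg i < a} + Fintype.card {j : Λ // B.deg j < b} +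
        Fintype.card {k : Λ // a + b ≤ B.deg k} := by
  refine (hasSliceRankLE_twistedTensor B t φ ψ hφ hψ a b).card_le_of_matching x y z
    fun i j l => ⟨fun hne => ?_, fun hijl => ?_⟩
  · -- some term is non-zero, hence some twist solves the equation
    by_contra hnot
    apply hne
    refine Finset.sum_eq_zero fun s _ => ?_
    have : ¬ (x i * φ s (y j) * ψ s (z l) = 1) := fun h => hnot (hoff i j l s h)
    simp [mulGroupTensor_apply, this]
  · obtain ⟨rfl, rfl⟩ := hijl
    simpa [mulGroupTensor_apply] using hdiag i

end Summit.MatrixMultiplication.MatrixMultiplication.Theorems.TwistedSliceRank
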